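import Mathlib.RingTheory.Polynomial.GaussLemma
import Mathlib.RingTheory.Localization.Integral
import Mathlib.Algebra.Polynomial.FieldDivision
import Mathlib.RingTheory.PrincipalIdealDomain
import Mathlib.LinearAlgebra.Matrix.Charpoly.Basic
import Mathlib.FieldTheory.RatFunc.Basic
import Literature.MathematicalPhysics.QuantumLattice.FinDimSpectrum

/-!
# Route `BalabanIR`, crux 5 `BirEveryGroundState` (`stmt-HubbardSuperconductivity-2083`):
# the SPECTRAL-CURVE toolkit, I (Theses-free) — anchor transfer and coprime blocks

First lemmas of the crux idea card `spectral-curve-anchor` (crux-ideate round 1, ideator 2),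
proved unconditionally and importing NO route file (rev-5 materialisation rule), so that a line
built on the card can import them. Companion: `BalabanIRBirEveryGroundStatePairing.lean`
(Kato isotropy, Shastry pairing).

The setting is the affine matrix pencil `U ↦ T + U • D` (sector Hamiltonian = hopping + `U` ·
doublon count) and its characteristic polynomial viewed as ONE polynomial in the energy variable
with coefficients in `ℂ[U]`, i.e. an element of `ℂ[U][X] = Polynomial (Polynomial ℂ)` (the
charpoly of `T.map C + X • D.map C`); specialising the coupling is `Polynomial.map (evalRingHom U₁)`
(`charpoly_pencil_map_evalRingHom`, the card's `PencilCharpolySpecialises`).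

* `exists_mul_add_mul_eq_C_of_isCoprime_map` — Bézout with denominators cleared: over a domain
  `R` with fraction field `K`, if `f, g ∈ R[X]` become coprime in `K[X]` then `a f + b g = C d`
  for some `a b ∈ R[X]` and `d ≠ 0` in `R`.
* `finite_setOf_exists_common_root`, `pencilCoprimeBlocksMeetFinitely` (the card's
  `CoprimeBlocksMeetFinitely`, polynomial and matrix forms) — two polynomials over `k[U]` coprime
  over `k(U)` (two symmetry blocks of the pencil with coprime characteristic polynomials) have a
  common specialised root (a common eigenvalue) at only finitely many couplings: a PERMANENT
  inter-block degeneracy is exactly a common factor.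
* `anchorTransfer` (the card's `AnchorTransfer`, exactly as printed) — for `χ` monic and `p` an
  irreducible factor of `χ` in `ℂ[U][X]`: if at ONE coupling `U₀` some root of `p(U₀, ·)` is a
  simple root of `χ(U₀, ·)` (an anchor), then at all but finitely many couplings every root of
  `p(U₁, ·)` is a simple root of `χ(U₁, ·)` — "multiplicity is constant along an irreducible
  component of the spectral curve": the anchor forces `p² ∤ χ`; Gauss's lemma moves
  irreducibility and non-divisibility to `ℂ(U)[X]`, where irreducible ⇒ coprime to the cofactor
  and to its own `X`-derivative; the two Bézout denominators carry the bad couplings.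
* `X_sub_C_dvd_charpoly_pencil_of_jointEigenvector` — a joint eigenvector of `T` and `D`
  (a "T/U state") contributes a LINEAR factor `X - (ε + γ U)` to the pencil's characteristic
  polynomial (the exactly solvable sheets `ℓ_ρ` the card splits off first).
* `pencilAnchorTransfer`, `pencilAnchorTransfer_real` (the card's `PencilAnchorTransfer`) and,
  through the dictionary `IsHermitian.rootMultiplicity_charpoly_eq_finrank_eigenspace`
  (multiplicity of a real root of `charpoly A` = dimension of the eigenspace, `A` Hermitian),
  `IsHermitian.finite_setOf_degenerate_of_anchor`: ONE non-degenerate level on the component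
  (e.g. Lieb's simple attractive ground state, `lieb_attractive_holds`) ⇒ the component's levels
  are non-degenerate at all but finitely many real couplings.

* `finrank_eigenspace_add_smul_vecMulVec_le_one` — under a RANK-ONE interaction every level
  off the free spectrum is simple (the mechanism of the card's provable base case `N = 2`).

What is NOT here (the card's load-bearing conjecture SC(L): squarefree / coprime INTERACTING
block factors for all large even `L`, and the connectivity of the window's ground sheet to an
anchored component) is untouched. Sources: Kato, *Perturbation Theory for Linear Operators*
(1966) II §1 (algebraic spectral curves of matrix pencils); Gauss's lemma (Mathlib
`Polynomial.IsPrimitive.irreducible_iff_irreducible_map_fraction_map`). Folklore algebra; no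
definition is introduced.
-/
noncomputable section

namespace Summit.HubbardSuperconductivity.HubbardSuperconductivity.Theorems

open Polynomial Matrix
open scoped Polynomial

section Bezout

variable {R K : Type*} [CommRing R] [IsDomain R] [Field K] [Algebra R K] [IsFractionRing R K]

/-- **Bézout with denominators cleared.** If `f g : R[X]` over a domain `R` become coprime in
`K[X]`, `K` the fraction field, then `a * f + b * g = C d` for some `a b : R[X]` and a NONZERO
`d : R` (write the Bézout coefficients over `K` with common denominators via
`IsLocalization.integerNormalization` and pull back along the injective `Polynomial.map`).
[folklore] -/
theorem exists_mul_add_mul_eq_C_of_isCoprime_map {f g : R[X]}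
    (h : IsCoprime (f.map (algebraMap R K)) (g.map (algebraMap R K))) :
    ∃ (a b : R[X]) (d : R), d ≠ 0 ∧ a * f + b * g = C d := by
  obtain ⟨u, v, huv⟩ := h
  obtain ⟨cu, hcu0, hcu⟩ := IsLocalization.integerNormalization_spec (nonZeroDivisors R) u
  obtain ⟨cv, hcv0, hcv⟩ := IsLocalization.integerNormalization_spec (nonZeroDivisors R) v
  refine ⟨C cv * IsLocalization.integerNormalization (nonZeroDivisors R) u,
    C cu * IsLocalization.integerNormalization (nonZeroDivisors R) v, cu * cv,
    mul_ne_zero (nonZeroDivisors.ne_zero hcu0) (nonZeroDivisors.ne_zero hcv0), ?_⟩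
  apply Polynomial.map_injective (algebraMap R K) (IsFractionRing.injective R K)
  rw [Polynomial.map_add, Polynomial.map_mul, Polynomial.map_mul, Polynomial.map_mul,
    Polynomial.map_mul, hcu, hcv, map_C, map_C, map_C, map_mul, C_mul, Algebra.smul_def,
    Algebra.smul_def, Polynomial.algebraMap_apply, Polynomial.algebraMap_apply]
  linear_combination (C (algebraMap R K cu) * C (algebraMap R K cv)) * huv

end Bezout

section Specialisation

variable {k : Type*} [Field k]

/-- **Coprime blocks meet finitely** (`CoprimeBlocksMeetFinitely`, polynomial form). Two
polynomials `f g ∈ k[U][X]` that are coprime over the rational function field `k(U)` acquire a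
common root under the specialisation `U ↦ U₁` for only finitely many `U₁ ∈ k`: by
`exists_mul_add_mul_eq_C_of_isCoprime_map`, `a f + b g = C d` with `d ≠ 0`, and a common root of
`f(U₁, ·), g(U₁, ·)` forces `d(U₁) = 0`. (Equivalently: the resultant `Res_X(f, g) ∈ k[U]` is a
nonzero polynomial.) [folklore] -/
theorem finite_setOf_exists_common_root {K : Type*} [Field K] [Algebra k[X] K]
    [IsFractionRing k[X] K] {f g : k[X][X]}
    (h : IsCoprime (f.map (algebraMap k[X] K)) (g.map (algebraMap k[X] K))) :
    Set.Finite {U₁ : k | ∃ μ : k, (f.map (evalRingHom U₁)).IsRoot μ ∧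
      (g.map (evalRingHom U₁)).IsRoot μ} := by
  obtain ⟨a, b, d, hd, hab⟩ := exists_mul_add_mul_eq_C_of_isCoprime_map h
  classical
  refine (d.roots.toFinset.finite_toSet).subset ?_
  rintro U₁ ⟨μ, hf, hg⟩
  have key := congrArg (fun q : k[X][X] => ((q.map (evalRingHom U₁)).eval μ)) hab
  simp only [Polynomial.map_add, Polynomial.map_mul, eval_add, eval_mul, map_C, eval_C,
    coe_evalRingHom] at key
  rw [hf.eq_zero, hg.eq_zero, mul_zero, mul_zero, add_zero] at key
  simp only [Finset.mem_coe, Multiset.mem_toFinset, mem_roots hd, IsRoot.def]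
  exact key.symm

/-- **Anchor transfer** (`AnchorTransfer` of the crux card `spectral-curve-anchor`, as printed).
Let `χ ∈ ℂ[U][X]` be monic in `X` (a characteristic polynomial of an affine pencil) and `p` an
irreducible factor of `χ`. If at ONE coupling `U₀` some root `μ` of `p(U₀, ·)` is a SIMPLE root of
`χ(U₀, ·)` (an anchor), then for all but finitely many couplings `U₁` every root of `p(U₁, ·)` is
a simple root of `χ(U₁, ·)`. Proof: `χ = p r`; the anchor forbids `p ∣ r` (else `μ` would be a
double root at `U₀`); `p` divides the monic `χ`, hence is primitive, so by Gauss's lemma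
`p` stays irreducible over `ℂ(U)` and still does not divide `r` there, whence `p, r` are coprime
over `ℂ(U)`; `p` is also coprime to `∂p/∂X ≠ 0` (degree); by `finite_setOf_exists_common_root`
both pairs have common specialised roots at finitely many `U₁` only, and elsewhere a root of
`p(U₁, ·)` is a simple root of `p(U₁, ·)` and no root of `r(U₁, ·)`, so has multiplicity one in
`χ(U₁, ·) = p(U₁, ·) r(U₁, ·)`. ("Multiplicity is constant along an irreducible component of the
spectral curve"; Kato 1966 II §1.) [folklore] -/
theorem anchorTransfer (χ p : ℂ[X][X]) (hχ : χ.Monic) (hp : Irreducible p) (hpχ : p ∣ χ)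
    (hanchor : ∃ U₀ μ : ℂ, (p.map (evalRingHom U₀)).IsRoot μ ∧
      (χ.map (evalRingHom U₀)).rootMultiplicity μ = 1) :
    Set.Finite {U₁ : ℂ | ∃ μ : ℂ, (p.map (evalRingHom U₁)).IsRoot μ ∧
      2 ≤ (χ.map (evalRingHom U₁)).rootMultiplicity μ} := by
  classical
  -- `p` divides the monic (hence primitive) `χ`, so is primitive, of positive degree
  have hprim : p.IsPrimitive := isPrimitive_of_dvd hχ.isPrimitive hpχ
  have hdeg : 0 < p.natDegree := by
    rw [Nat.pos_iff_ne_zero]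
    intro h0
    apply hp.not_isUnit
    rw [eq_C_of_natDegree_eq_zero h0]
    exact isUnit_C.mpr (hprim _ (eq_C_of_natDegree_eq_zero h0).symm.dvd)
  obtain ⟨r, hr⟩ := hpχ
  -- specialisations of `χ` are monic, hence nonzero
  have hχU : ∀ U₁ : ℂ, χ.map (evalRingHom U₁) ≠ 0 := fun U₁ => (hχ.map _).ne_zero
  have hχU' : ∀ U₁ : ℂ, p.map (evalRingHom U₁) * r.map (evalRingHom U₁) ≠ 0 := fun U₁ => by
    rw [← Polynomial.map_mul, ← hr]; exact hχU U₁
  -- the anchor forbids `p ∣ r`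
  have hndvd : ¬ p ∣ r := by
    rintro ⟨s, hs⟩
    obtain ⟨U₀, μ, hroot, hmult⟩ := hanchor
    have hfac : χ.map (evalRingHom U₀) =
        p.map (evalRingHom U₀) * (p.map (evalRingHom U₀) * s.map (evalRingHom U₀)) := by
      rw [hr, hs, Polynomial.map_mul, Polynomial.map_mul]
    have hne : p.map (evalRingHom U₀) * (p.map (evalRingHom U₀) * s.map (evalRingHom U₀)) ≠ 0 :=
      hfac ▸ hχU U₀
    have hp0 : p.map (evalRingHom U₀) ≠ 0 := left_ne_zero_of_mul hne
    have hpos : 0 < (p.map (evalRingHom U₀)).rootMultiplicity μ :=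
      (rootMultiplicity_pos hp0).mpr hroot
    rw [hfac, rootMultiplicity_mul hne, rootMultiplicity_mul (right_ne_zero_of_mul hne)] at hmult
    omega
  -- Gauss: over the fraction field `p` is irreducible and coprime to `r` and to `p'`
  -- (the rational function field `RatFunc ℂ` serves as the fraction field of `ℂ[U]`)
  set φ : ℂ[X] →+* RatFunc ℂ := algebraMap ℂ[X] (RatFunc ℂ) with hφ
  have hφinj : Function.Injective φ := IsFractionRing.injective ℂ[X] (RatFunc ℂ)
  have hirrK : Irreducible (p.map φ) := (hprim.irreducible_iff_irreducible_map_fraction_map).mp hp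
  have hcopr : IsCoprime (p.map φ) (r.map φ) := by
    refine hirrK.coprime_iff_not_dvd.mpr fun hK' => hndvd ?_
    exact (hprim.dvd_iff_fraction_map_dvd_fraction_map (RatFunc ℂ)).mpr hK'
  have hdegK : (p.map φ).natDegree = p.natDegree := natDegree_map_eq_of_injective hφinj p
  have hcopd : IsCoprime (p.map φ) ((derivative p).map φ) := by
    rw [← derivative_map]
    refine hirrK.coprime_iff_not_dvd.mpr fun hK' => ?_
    have hd0 : derivative (p.map φ) ≠ 0 := by
      intro h0
      have := Polynomial.derivative_eq_zero.mp h0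
      omega
    have hle := natDegree_le_of_dvd hK' hd0
    have hlt := natDegree_derivative_lt (p := p.map φ) (by omega)
    omega
  -- the two finite exceptional sets
  have hS₁ := finite_setOf_exists_common_root hcopd
  have hS₂ := finite_setOf_exists_common_root hcopr
  refine (hS₁.union hS₂).subset ?_
  rintro U₁ ⟨μ, hroot, hmult⟩
  by_cases hrU : (r.map (evalRingHom U₁)).IsRoot μ
  · exact Or.inr ⟨μ, hroot, hrU⟩
  · left
    refine ⟨μ, hroot, ?_⟩
    have hne := hχU' U₁
    rw [hr, Polynomial.map_mul, rootMultiplicity_mul hne, rootMultiplicity_eq_zero hrU,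
      add_zero] at hmult
    have hp0 : p.map (evalRingHom U₁) ≠ 0 := left_ne_zero_of_mul hne
    have h1 := ((one_lt_rootMultiplicity_iff_isRoot (t := μ) hp0).mp (by omega)).2
    rwa [derivative_map] at h1

end Specialisation

section Pencil

variable {n : Type*} [Fintype n] [DecidableEq n]

/-- **The pencil characteristic polynomial specialises** (`PencilCharpolySpecialises`): the
characteristic polynomial of the matrix `T.map C + X • D.map C` over `ℂ[U]` (the affine pencil
with INDETERMINATE coupling) specialises under `U ↦ U₁` to the characteristic polynomial of
`T + U₁ • D` (`Matrix.charpoly_map`). [folklore] -/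
theorem charpoly_pencil_map_evalRingHom (T D : Matrix n n ℂ) (U₁ : ℂ) :
    (T.map C + (X : ℂ[X]) • D.map C).charpoly.map (evalRingHom U₁) = (T + U₁ • D).charpoly := by
  rw [← Matrix.charpoly_map]
  congr 1
  ext i j
  simp [Matrix.map_apply, Matrix.add_apply, Matrix.smul_apply]
  ring

/-- **T/U sheets are linear factors.** A joint eigenvector `v ≠ 0` of `T` and `D`
(`T v = ε v`, `D v = γ v` — a "T/U state", Bruus–Anglès d'Auriac 1997 §5.2) is an eigenvector of
the whole pencil with the AFFINE eigenvalue `ε + γ U`, so the linear form `X - (ε + γ U)` divides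
the pencil's characteristic polynomial in `ℂ[U][X]` (the remainder `χ(U, ε + γ U) ∈ ℂ[U]`
vanishes at every complex `U`, hence is zero). These exactly solvable sheets are split off before
any genericity claim (`χ_ρ = ℓ_ρ · χ_ρ^int` on the card). [folklore] -/
theorem X_sub_C_dvd_charpoly_pencil_of_jointEigenvector (T D : Matrix n n ℂ) {v : n → ℂ}
    (hv : v ≠ 0) {ε γ : ℂ} (hTv : T *ᵥ v = ε • v) (hDv : D *ᵥ v = γ • v) :
    (X - C (C ε + C γ * X)) ∣ (T.map C + (X : ℂ[X]) • D.map C).charpoly := by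
  rw [dvd_iff_isRoot, IsRoot.def]
  apply Polynomial.funext
  intro U₁
  have key : ((T.map C + (X : ℂ[X]) • D.map C).charpoly.map (evalRingHom U₁)).eval
      (ε + γ * U₁) = 0 := by
    rw [charpoly_pencil_map_evalRingHom, eval_charpoly, ← Matrix.exists_mulVec_eq_zero_iff]
    refine ⟨v, hv, ?_⟩
    rw [sub_mulVec, add_mulVec, smul_mulVec, hTv, hDv, smul_smul]
    ext i
    simp [Matrix.scalar_apply, Pi.smul_apply]
    ring
  have ha : evalRingHom U₁ (C ε + C γ * X) = ε + γ * U₁ := by simp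
  rw [← ha, eval_map, eval₂_at_apply, coe_evalRingHom] at key
  simpa using key

/-- **Anchor transfer for an affine matrix pencil** (`PencilAnchorTransfer`, complex couplings).
If `p ∈ ℂ[U][X]` is an irreducible factor of the pencil's characteristic polynomial and ONE
specialised root of `p` is a simple root of `charpoly (T + U₀ • D)`, then at all but finitely
many complex couplings `U₁` every root of `p(U₁, ·)` is a simple root of `charpoly (T + U₁ • D)`
(`anchorTransfer` + `charpoly_pencil_map_evalRingHom`). [folklore] -/
theorem pencilAnchorTransfer (T D : Matrix n n ℂ) (p : ℂ[X][X]) (hp : Irreducible p)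
    (hpχ : p ∣ (T.map C + (X : ℂ[X]) • D.map C).charpoly)
    (hanchor : ∃ U₀ μ : ℂ, (p.map (evalRingHom U₀)).IsRoot μ ∧
      (T + U₀ • D).charpoly.rootMultiplicity μ = 1) :
    Set.Finite {U₁ : ℂ | ∃ μ : ℂ, (p.map (evalRingHom U₁)).IsRoot μ ∧
      2 ≤ (T + U₁ • D).charpoly.rootMultiplicity μ} := by
  have h := anchorTransfer _ p (Matrix.charpoly_monic _) hp hpχ
    (by simpa only [charpoly_pencil_map_evalRingHom] using hanchor)
  simpa only [charpoly_pencil_map_evalRingHom] using h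

/-- **Anchor transfer, real couplings** (`PencilAnchorTransfer`, the form used on a coupling
window): same statement with `U₁` ranging over `ℝ` (preimage of a finite set under the injective
coercion `ℝ → ℂ`). [folklore] -/
theorem pencilAnchorTransfer_real (T D : Matrix n n ℂ) (p : ℂ[X][X]) (hp : Irreducible p)
    (hpχ : p ∣ (T.map C + (X : ℂ[X]) • D.map C).charpoly)
    (hanchor : ∃ U₀ μ : ℂ, (p.map (evalRingHom U₀)).IsRoot μ ∧
      (T + U₀ • D).charpoly.rootMultiplicity μ = 1) :
    Set.Finite {U₁ : ℝ | ∃ μ : ℂ, (p.map (evalRingHom (U₁ : ℂ))).IsRoot μ ∧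
      2 ≤ (T + (U₁ : ℂ) • D).charpoly.rootMultiplicity μ} := by
  refine ((pencilAnchorTransfer T D p hp hpχ hanchor).preimage (f := ((↑) : ℝ → ℂ))
    Complex.ofReal_injective.injOn).subset ?_
  intro U₁ hU
  exact hU

/-- **Multiplicity dictionary.** For a Hermitian matrix `A` and a real number `μ`, the
multiplicity of `μ` as a root of the characteristic polynomial equals the dimension of the
eigenspace `ker (A - μ)` (`IsHermitian.charpoly_eq` : `charpoly A = ∏ᵢ (X - C λᵢ)`, and
`IsHermitian.card_filter_eigenvalues_eq`). So "`μ` is a simple root" = "non-degenerate level"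
and "`2 ≤` multiplicity" = "degenerate level". [folklore] -/
theorem IsHermitian.rootMultiplicity_charpoly_eq_finrank_eigenspace {A : Matrix n n ℂ}
    (hA : A.IsHermitian) (μ : ℝ) :
    A.charpoly.rootMultiplicity (μ : ℂ) =
      Module.finrank ℂ (Module.End.eigenspace (Matrix.toLin' A) (μ : ℂ)) := by
  classical
  rw [← hA.card_filter_eigenvalues_eq μ, ← count_roots, hA.roots_charpoly_eq_eigenvalues,
    Multiset.count_map]
  rw [← Finset.filter_val, Finset.card_val]
  congr 1
  ext i
  simp only [Finset.mem_filter, Finset.mem_univ, true_and, Function.comp_apply]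
  constructor
  · intro h; exact (RCLike.ofReal_inj.mp h).symm
  · intro h; rw [h]; rfl

/-- **Coprime blocks meet finitely, matrix form** (`CoprimeBlocksMeetFinitely`). Two affine
pencils `T + U • D` (size `n`) and `T' + U • D'` (size `m`) — two symmetry blocks of one
Hamiltonian pencil — whose characteristic polynomials are coprime over `ℂ(U)` have a common
eigenvalue at only finitely many complex couplings `U₁`: a PERMANENT inter-block degeneracy is
exactly a common factor of the two block characteristic polynomials.
(`finite_setOf_exists_common_root` + `charpoly_pencil_map_evalRingHom`.) [folklore] -/
theorem pencilCoprimeBlocksMeetFinitely {m : Type*} [Fintype m] [DecidableEq m]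
    {K : Type*} [Field K] [Algebra ℂ[X] K] [IsFractionRing ℂ[X] K]
    (T D : Matrix n n ℂ) (T' D' : Matrix m m ℂ)
    (h : IsCoprime ((T.map C + (X : ℂ[X]) • D.map C).charpoly.map (algebraMap ℂ[X] K))
      ((T'.map C + (X : ℂ[X]) • D'.map C).charpoly.map (algebraMap ℂ[X] K))) :
    Set.Finite {U₁ : ℂ | ∃ μ : ℂ, (T + U₁ • D).charpoly.IsRoot μ ∧
      (T' + U₁ • D').charpoly.IsRoot μ} := by
  simpa only [charpoly_pencil_map_evalRingHom] using finite_setOf_exists_common_root h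

/-- **Anchor transfer for a Hermitian pencil, in eigenspace language.** For Hermitian `T, D`, real
couplings and real energies: if `p` is an irreducible factor of the pencil's characteristic
polynomial and at ONE real coupling `U₀` some real root `μ₀` of `p(U₀, ·)` is a NON-DEGENERATE
level of `T + U₀ • D` (eigenspace of dimension one — e.g. Lieb's simple attractive ground state),
then at all but finitely many real couplings `U₁` every real root of `p(U₁, ·)` is a non-degenerate
level of `T + U₁ • D` (`pencilAnchorTransfer_real` +
`IsHermitian.rootMultiplicity_charpoly_eq_finrank_eigenspace`). [folklore] -/
theorem IsHermitian.finite_setOf_degenerate_of_anchor {T D : Matrix n n ℂ} (hT : T.IsHermitian)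
    (hD : D.IsHermitian) (p : ℂ[X][X]) (hp : Irreducible p)
    (hpχ : p ∣ (T.map C + (X : ℂ[X]) • D.map C).charpoly)
    (hanchor : ∃ U₀ μ₀ : ℝ, (p.map (evalRingHom (U₀ : ℂ))).IsRoot (μ₀ : ℂ) ∧
      Module.finrank ℂ (Module.End.eigenspace (Matrix.toLin' (T + (U₀ : ℂ) • D)) (μ₀ : ℂ)) = 1) :
    Set.Finite {U₁ : ℝ | ∃ μ : ℝ, (p.map (evalRingHom (U₁ : ℂ))).IsRoot (μ : ℂ) ∧
      2 ≤ Module.finrank ℂ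
        (Module.End.eigenspace (Matrix.toLin' (T + (U₁ : ℂ) • D)) (μ : ℂ))} := by
  have hH : ∀ U : ℝ, (T + (U : ℂ) • D).IsHermitian := fun U => by
    refine hT.add ?_
    have : ((U : ℂ) • D)ᴴ = (U : ℂ) • D := by
      rw [conjTranspose_smul, hD.eq, Complex.star_def, Complex.conj_ofReal]
    exact this
  obtain ⟨U₀, μ₀, hroot, hsimple⟩ := hanchor
  have hfin := pencilAnchorTransfer_real T D p hp hpχ ⟨U₀, μ₀, hroot, by
    rw [IsHermitian.rootMultiplicity_charpoly_eq_finrank_eigenspace (hH U₀) μ₀, hsimple]⟩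
  refine hfin.subset ?_
  rintro U₁ ⟨μ, hμ, hdeg⟩
  exact ⟨μ, hμ, by
    rwa [IsHermitian.rootMultiplicity_charpoly_eq_finrank_eigenspace (hH U₁) μ]⟩

end Pencil


section RankOne

variable {n : Type*} [Fintype n] [DecidableEq n]

/-- **Rank-one interaction: interacting levels are simple** (the mechanism of the card's provable
base case `N = 2`, where in each total-momentum block the on-site interaction is the rank-one
matrix `|d_K⟩⟨d_K|`). For ANY matrix `T`, a rank-one perturbation `U • vecMulVec d f`
(`x ↦ U (f ⬝ x) d`) and a number `μ` that is NOT an eigenvalue of `T`, the eigenspace of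
`T + U • vecMulVec d f` at `μ` is at most one-dimensional: on it `x ↦ f ⬝ x` is injective
(`f ⬝ x = 0` forces `T x = μ x`, so `x = 0`), a linear injection into `ℂ`. So every
"interacting" level (off the spectrum of `T`: a root of the secular equation
`1 = U ⟨f, (μ - T)⁻¹ d⟩`) is simple, for every coupling at once. [folklore] -/
theorem finrank_eigenspace_add_smul_vecMulVec_le_one (T : Matrix n n ℂ) (d f : n → ℂ) (U μ : ℂ)
    (hμ : ∀ x : n → ℂ, T *ᵥ x = μ • x → x = 0) :
    Module.finrank ℂ (Module.End.eigenspace (Matrix.toLin' (T + U • vecMulVec d f)) μ) ≤ 1 := by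
  set E := Module.End.eigenspace (Matrix.toLin' (T + U • vecMulVec d f)) μ with hE
  -- the functional `x ↦ f ⬝ x` restricted to the eigenspace
  let φ : E →ₗ[ℂ] ℂ :=
    { toFun := fun x => f ⬝ᵥ (x : n → ℂ)
      map_add' := fun x y => by simp [dotProduct_add]
      map_smul' := fun c x => by simp [dotProduct_smul] }
  have hinj : Function.Injective φ := by
    rw [injective_iff_map_eq_zero]
    intro x hx
    have hx' : f ⬝ᵥ (x : n → ℂ) = 0 := hx
    have hmem := x.2
    rw [Module.End.mem_eigenspace_iff, Matrix.toLin'_apply, add_mulVec, smul_mulVec,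
      vecMulVec_mulVec, hx'] at hmem
    simp only [MulOpposite.op_zero, zero_smul, smul_zero, add_zero] at hmem
    exact Subtype.ext (hμ _ hmem)
  simpa using LinearMap.finrank_le_finrank_of_injective hinj

end RankOne

end Summit.HubbardSuperconductivity.HubbardSuperconductivity.Theorems
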